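import Summits.AtomisticToContinuum.BoseEinsteinCondensation.Theses.BECDispersionLadder

/-!
# Route BECDispersionLadder — the deciding crux `Target` is DERIVED from its ladder (BC2 redirect)

`Target` (stmt-AtomisticToContinuum-14554, X = uniform dial condensation) is the conclusion of the
route's own two rungs: `OpenSideBEC` (stmt-14555, rung 1: condensation of the δ-near-minimisers of
the fractional torus energy `E_α` for every FIXED `α ∈ (1,2)`) and `DialUniformity` (stmt-14556,
rung 2: the condensation constants can be chosen uniformly on a window `(α₀,2)` — stated as
OpenSideBEC-body → Target-body).  This file lands the split assembly with the type spelled out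
literally as `OpenSideBEC → DialUniformity → Target`, the shape consumed by
`ledger route edit --split Target --into … --glue-by`, so that `Target` becomes a derived node and
the two rungs are the route's leaves.  The seam is modus ponens (`trivial_seam`): the content of the
redirect is in the two pieces, each of which has its own registered skeleton under
`Cruxes/OpenSideBEC/Lines/` and `Cruxes/DialUniformity/Lines/`.  (The glue ITEM `LadderToTarget`,
stmt-14106, states the same implication behind a `def` and is closed by `ladderToTarget_proof`.)
-/

namespace Summit.AtomisticToContinuum.BoseEinsteinCondensation.Theorems

open Summit.AtomisticToContinuum.BoseEinsteinCondensation.Theses.BECDispersionLadder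

/-- **Split assembly for `Target`** (BC2 redirect of stmt-AtomisticToContinuum-14554):
`OpenSideBEC → DialUniformity → Target`.  `DialUniformity` unfolds definitionally to the
implication from the body of `OpenSideBEC` to the body of `Target`, so the assembly is modus
ponens; the kernel checks that the three route decls line up verbatim. -/
theorem target_of_subs : OpenSideBEC → DialUniformity → Target :=
  fun h₁ h₂ => h₂ h₁

end Summit.AtomisticToContinuum.BoseEinsteinCondensation.Theorems
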